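import Mathlib
import Summits.Ventures.PercRepro.TriangleCapCherryMantel

/-!
# PercRepro — the positive part of ROW C-047 in the kernel: `Σ_v C(d(v), 2) ≤ C(m, 2)` for every finite
simple graph, with equality exactly when the edges are pairwise adjacent (p3, gen 29)

ROW C-047 (TriangleCapC047Refutation) claimed `Σ_v C(d_D(v), 2) ≤ B_k(m)` for every `K₄⁻`-free graph `D` on
`k` vertices with `m ≥ 1` edges, with equality iff the edges are pairwise adjacent; it is FALSE for
`m = 3(k − 3)` at every `k ≥ 28` (TriangleCapC047Family).  Its row text says «trivial for `m ≤ k`»: in that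
regime `B_k(m) = C(m, 2)` (the first `m − 1` terms of the staircase `1 .. k−1, 1 .. k, …` are `1 + ⋯ + (m−1)`),
and `Σ_v C(d(v), 2)` counts the pairs of distinct edges sharing a vertex, which are at most `C(m, 2)` of the
`C(m, 2)` pairs of edges.  This module is that statement as a tree theorem, by the degree-sum method of the
lane (Mantel module):

* `deg_add_deg_le_card_edges_succ_of_adj` — two adjacent vertices `v ~ w` have `d(v) + d(w) ≤ m + 1`: their
  incidence sets meet exactly in the edge `s(v, w)` (`incidenceFinset_inter_of_adj`); and
  `deg_add_deg_eq_iff` — equality iff every edge contains `v` or `w`;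
* `sum_deg_mul_deg_le_card_edges` — `Σ_v d(v)² ≤ m (m + 1)`, summing over the ordered adjacent pairs;
* **`cherries_le_choose_two`** — `Σ_v C(d(v), 2) ≤ C(m, 2)` for EVERY finite simple graph;
* **`cherries_eq_choose_two_iff`** — `Σ_v C(d(v), 2) = C(m, 2)` iff the edges are pairwise adjacent
  (`pairwiseAdjacent_of_cherries_eq`, `cherries_eq_of_pairwiseAdjacent`);
* `B_eq_choose_two_of_le` — `B_k(m) = C(m, 2)` for `1 ≤ m ≤ k` (`KK.P_closed` in the first run);
* **`rowC047_of_le`** / **`eqClauseC047_of_le`** / `cherries_eq_B_of_pairwiseAdjacent` — ROW C-047 and its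
  equality clause hold for `m ≤ k` (for every graph: the `K₄⁻`-free hypothesis is not even needed).

So the row's truth is exactly the regime `m ≤ k` where its bound is the trivial pair count; its first
non-trivial window `k < m` is where it dies (`m = 3(k−3)`, `k ≥ 28`).  Axioms: standard.
-/

namespace PercRepro

namespace TriangleCap

namespace C047

open Finset

variable {V : Type*} [Fintype V] [DecidableEq V]

/-- `d(v)` is the number of edges at `v`. -/
theorem deg_eq_card_incidenceFinset (D : SimpleGraph V) [DecidableRel D.Adj] (v : V) :
    deg D v = (D.incidenceFinset v).card := by
  rw [deg_eq_degree, SimpleGraph.card_incidenceFinset_eq_degree]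

/-- The incidence sets of two adjacent vertices meet exactly in their edge. -/
theorem incidenceFinset_inter_of_adj (D : SimpleGraph V) [DecidableRel D.Adj] {v w : V}
    (h : D.Adj v w) : D.incidenceFinset v ∩ D.incidenceFinset w = {s(v, w)} := by
  ext e
  rw [mem_inter, SimpleGraph.mem_incidenceFinset, SimpleGraph.mem_incidenceFinset, mem_singleton]
  constructor
  · intro he
    have hmem : e ∈ D.incidenceSet v ∩ D.incidenceSet w := he
    rw [D.incidenceSet_inter_incidenceSet_of_adj h] at hmem
    exact hmem
  · rintro rfl
    exact ⟨D.mk'_mem_incidenceSet_left_iff.2 h, D.mk'_mem_incidenceSet_right_iff.2 h⟩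

/-- **Two adjacent vertices see at most `m + 1` edge-ends:** `d(v) + d(w) ≤ m + 1` for `v ~ w`
(the edges at `v` or at `w` number `d(v) + d(w) − 1 ≤ m`). -/
theorem deg_add_deg_le_card_edges_succ_of_adj (D : SimpleGraph V) [DecidableRel D.Adj] {v w : V}
    (h : D.Adj v w) : deg D v + deg D w ≤ D.edgeFinset.card + 1 := by
  have h1 := card_union_add_card_inter (D.incidenceFinset v) (D.incidenceFinset w)
  rw [incidenceFinset_inter_of_adj D h, card_singleton] at h1
  have h2 : (D.incidenceFinset v ∪ D.incidenceFinset w).card ≤ D.edgeFinset.card :=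
    card_le_card (union_subset (D.incidenceFinset_subset v) (D.incidenceFinset_subset w))
  rw [deg_eq_card_incidenceFinset, deg_eq_card_incidenceFinset]
  omega

/-- `d(v) + d(w) = m + 1` for adjacent `v ~ w` iff every edge contains `v` or `w`. -/
theorem deg_add_deg_eq_iff (D : SimpleGraph V) [DecidableRel D.Adj] {v w : V} (h : D.Adj v w) :
    deg D v + deg D w = D.edgeFinset.card + 1 ↔ ∀ f ∈ D.edgeFinset, v ∈ f ∨ w ∈ f := by
  have h1 := card_union_add_card_inter (D.incidenceFinset v) (D.incidenceFinset w)
  rw [incidenceFinset_inter_of_adj D h, card_singleton] at h1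
  have hsub : D.incidenceFinset v ∪ D.incidenceFinset w ⊆ D.edgeFinset :=
    union_subset (D.incidenceFinset_subset v) (D.incidenceFinset_subset w)
  rw [deg_eq_card_incidenceFinset, deg_eq_card_incidenceFinset]
  constructor
  · intro heq f hf
    have hcard : D.edgeFinset.card ≤ (D.incidenceFinset v ∪ D.incidenceFinset w).card := by omega
    have hU := eq_of_subset_of_card_le hsub hcard
    have hf' : f ∈ D.incidenceFinset v ∪ D.incidenceFinset w := by rw [hU]; exact hf
    rw [mem_union, SimpleGraph.mem_incidenceFinset, SimpleGraph.mem_incidenceFinset] at hf'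
    rcases hf' with hv | hw
    · exact Or.inl hv.2
    · exact Or.inr hw.2
  · intro hall
    have hsup : D.edgeFinset ⊆ D.incidenceFinset v ∪ D.incidenceFinset w := by
      intro f hf
      rw [mem_union, SimpleGraph.mem_incidenceFinset, SimpleGraph.mem_incidenceFinset]
      have hfe : f ∈ D.edgeSet := SimpleGraph.mem_edgeFinset.mp hf
      rcases hall f hf with hv | hw
      · exact Or.inl ⟨hfe, hv⟩
      · exact Or.inr ⟨hfe, hw⟩
    rw [Subset.antisymm hsub hsup] at h1
    omega

omit [DecidableEq V] in
/-- `Σ_{(v,w) adjacent, ordered} (d(v) + d(w)) = 2 Σ_v d(v)²`. -/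
theorem sum_adjPairsAll_deg_add (D : SimpleGraph V) [DecidableRel D.Adj] :
    ∑ p ∈ adjPairsAll D, (deg D p.1 + deg D p.2) = 2 * ∑ v, deg D v * deg D v := by
  rw [sum_add_distrib, sum_snd_adjPairsAll, sum_fst_adjPairsAll]
  ring

/-- **`Σ_v d(v)² ≤ m (m + 1)`** for every finite simple graph with `m` edges. -/
theorem sum_deg_mul_deg_le_card_edges (D : SimpleGraph V) [DecidableRel D.Adj] :
    ∑ v, deg D v * deg D v ≤ D.edgeFinset.card * (D.edgeFinset.card + 1) := by
  have h2 : ∑ p ∈ adjPairsAll D, (deg D p.1 + deg D p.2) ≤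
      ∑ p ∈ adjPairsAll D, (D.edgeFinset.card + 1) :=
    sum_le_sum (fun p hp => deg_add_deg_le_card_edges_succ_of_adj D (mem_filter.mp hp).2)
  rw [sum_const, smul_eq_mul, card_adjPairsAll, sum_adjPairsAll_deg_add, mul_assoc] at h2
  exact Nat.le_of_mul_le_mul_left h2 (by norm_num)

/-- **THE PAIR COUNT:** `Σ_v C(d(v), 2) ≤ C(m, 2)` for every finite simple graph with `m` edges. -/
theorem cherries_le_choose_two (D : SimpleGraph V) [DecidableRel D.Adj] :
    cherries D ≤ (D.edgeFinset.card).choose 2 := by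
  have h := sum_deg_mul_deg_le_card_edges D
  rw [← two_mul_cherries_add, sum_deg_eq] at h
  have h2 := two_mul_choose_two_add D.edgeFinset.card
  nlinarith [h, h2]

/-- If `Σ_v C(d(v), 2) = C(m, 2)` then every edge is full: `d(v) + d(w) = m + 1` on every `v ~ w`. -/
theorem deg_add_deg_eq_of_cherries_eq (D : SimpleGraph V) [DecidableRel D.Adj]
    (heq : cherries D = (D.edgeFinset.card).choose 2) {v w : V} (h : D.Adj v w) :
    deg D v + deg D w = D.edgeFinset.card + 1 := by
  have hsq : ∑ v, deg D v * deg D v = D.edgeFinset.card * (D.edgeFinset.card + 1) := by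
    have h1 := two_mul_cherries_add D
    rw [sum_deg_eq, heq] at h1
    have h2 := two_mul_choose_two_add D.edgeFinset.card
    nlinarith [h1, h2]
  have hle : ∀ p ∈ adjPairsAll D, deg D p.1 + deg D p.2 ≤ D.edgeFinset.card + 1 :=
    fun p hp => deg_add_deg_le_card_edges_succ_of_adj D (mem_filter.mp hp).2
  have hsum : ∑ p ∈ adjPairsAll D, (deg D p.1 + deg D p.2) =
      ∑ p ∈ adjPairsAll D, (D.edgeFinset.card + 1) := by
    rw [sum_const, smul_eq_mul, card_adjPairsAll, sum_adjPairsAll_deg_add, hsq]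
    ring
  have hall := (sum_eq_sum_iff_of_le hle).mp hsum
  have hp : (v, w) ∈ adjPairsAll D := by
    unfold adjPairsAll
    rw [mem_filter, mem_product]
    exact ⟨⟨mem_univ _, mem_univ _⟩, h⟩
  exact hall (v, w) hp

/-- **Equality forces pairwise adjacent edges:** `Σ_v C(d(v), 2) = C(m, 2)` ⇒ every two distinct edges
share a vertex. -/
theorem pairwiseAdjacent_of_cherries_eq (D : SimpleGraph V) [DecidableRel D.Adj]
    (heq : cherries D = (D.edgeFinset.card).choose 2) : PairwiseAdjacent D := by
  intro e he f hf hne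
  revert he hne
  refine Sym2.ind (fun v w => ?_) e
  intro he _
  have hadj : D.Adj v w := D.mem_edgeSet.mp (SimpleGraph.mem_edgeFinset.mp he)
  have hfull := deg_add_deg_eq_of_cherries_eq D heq hadj
  rcases (deg_add_deg_eq_iff D hadj).mp hfull f hf with hv | hw
  · exact ⟨v, Sym2.mem_mk_left v w, hv⟩
  · exact ⟨w, Sym2.mem_mk_right v w, hw⟩

/-- **Pairwise adjacent edges attain the pair count:** `Σ_v C(d(v), 2) = C(m, 2)`. -/
theorem cherries_eq_of_pairwiseAdjacent (D : SimpleGraph V) [DecidableRel D.Adj]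
    (hpa : PairwiseAdjacent D) : cherries D = (D.edgeFinset.card).choose 2 := by
  have hfull : ∀ p ∈ adjPairsAll D, deg D p.1 + deg D p.2 = D.edgeFinset.card + 1 := by
    intro p hp
    have hadj : D.Adj p.1 p.2 := (mem_filter.mp hp).2
    rw [deg_add_deg_eq_iff D hadj]
    intro f hf
    by_cases hef : s(p.1, p.2) = f
    · rw [← hef]
      exact Or.inl (Sym2.mem_mk_left _ _)
    · have he : s(p.1, p.2) ∈ D.edgeFinset := SimpleGraph.mem_edgeFinset.mpr hadj
      obtain ⟨x, hxe, hxf⟩ := hpa _ he f hf hef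
      rcases Sym2.mem_iff.mp hxe with rfl | rfl
      · exact Or.inl hxf
      · exact Or.inr hxf
  have hsum : ∑ p ∈ adjPairsAll D, (deg D p.1 + deg D p.2) =
      ∑ p ∈ adjPairsAll D, (D.edgeFinset.card + 1) := sum_congr rfl hfull
  rw [sum_const, smul_eq_mul, card_adjPairsAll, sum_adjPairsAll_deg_add] at hsum
  have h2 := two_mul_cherries_add D
  rw [sum_deg_eq] at h2
  have h3 := two_mul_choose_two_add D.edgeFinset.card
  nlinarith [hsum, h2, h3]

/-- **THE EQUALITY CLAUSE OF THE PAIR COUNT:** `Σ_v C(d(v), 2) = C(m, 2)` iff the edges are pairwise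
adjacent. -/
theorem cherries_eq_choose_two_iff (D : SimpleGraph V) [DecidableRel D.Adj] :
    cherries D = (D.edgeFinset.card).choose 2 ↔ PairwiseAdjacent D :=
  ⟨pairwiseAdjacent_of_cherries_eq D, cherries_eq_of_pairwiseAdjacent D⟩

/-- In the first run of the staircase the row's bound is the pair count: `B_k(m) = C(m, 2)` for `1 ≤ m ≤ k`. -/
theorem B_eq_choose_two_of_le (k m : ℕ) (hk : 2 ≤ k) (h1 : 1 ≤ m) (h2 : m ≤ k) :
    B k m = m.choose 2 := by
  unfold B
  obtain ⟨t, rfl⟩ : ∃ t, k = t + 2 := ⟨k - 2, by omega⟩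
  obtain ⟨i, rfl⟩ : ∃ i, m = i + 1 := ⟨m - 1, by omega⟩
  have e : (t + 2 - 1).choose 2 + (i + 1) - 1 = KK.tri t + i := by
    rw [KK.tri_eq_choose]
    have e' : t + 2 - 1 = t + 1 := by omega
    rw [e']
    omega
  rw [e, KK.P_closed t i (by omega)]
  omega

/-- **ROW C-047 HOLDS FOR `m ≤ k`** — for every graph on `Fin k` (no `K₄⁻` hypothesis is needed):
`Σ_v C(d(v), 2) ≤ B_k(m)` when `1 ≤ m ≤ k`. -/
theorem rowC047_of_le (k : ℕ) (hk : 3 ≤ k) (D : SimpleGraph (Fin k)) [DecidableRel D.Adj]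
    (h1 : 1 ≤ D.edgeFinset.card) (h2 : D.edgeFinset.card ≤ k) :
    cherries D ≤ B k D.edgeFinset.card := by
  rw [B_eq_choose_two_of_le k _ (by omega) h1 h2]
  exact cherries_le_choose_two D

/-- **THE EQUALITY CLAUSE OF ROW C-047 HOLDS FOR `m ≤ k`:** equality in the bound forces the edges to be
pairwise adjacent. -/
theorem eqClauseC047_of_le (k : ℕ) (hk : 3 ≤ k) (D : SimpleGraph (Fin k)) [DecidableRel D.Adj]
    (h1 : 1 ≤ D.edgeFinset.card) (h2 : D.edgeFinset.card ≤ k)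
    (heq : cherries D = B k D.edgeFinset.card) : PairwiseAdjacent D := by
  rw [B_eq_choose_two_of_le k _ (by omega) h1 h2] at heq
  exact pairwiseAdjacent_of_cherries_eq D heq

/-- Conversely, pairwise adjacent edges attain the row's bound for `m ≤ k`. -/
theorem cherries_eq_B_of_pairwiseAdjacent (k : ℕ) (hk : 3 ≤ k) (D : SimpleGraph (Fin k))
    [DecidableRel D.Adj] (h1 : 1 ≤ D.edgeFinset.card) (h2 : D.edgeFinset.card ≤ k)
    (hpa : PairwiseAdjacent D) : cherries D = B k D.edgeFinset.card := by
  rw [B_eq_choose_two_of_le k _ (by omega) h1 h2]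
  exact cherries_eq_of_pairwiseAdjacent D hpa

end C047

end TriangleCap

end PercRepro
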